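import Summits.BirchSwinnertonDyer.BirchSwinnertonDyer.Theorems.GenusKolyvaginAtTwoExactDescentAtTwoOfFourFacts
import HarnessLib

/-!
# Route `GenusKolyvaginAtTwo`, item stmt-BirchSwinnertonDyer-24238 `ExactDescentAtTwoOfFourFacts` — CLOSED BY NAME

The planner's rev-3 twin of crux #4 `ExactDescentAtTwo` (22138, now ASIDE) with its four published inputs as antecedents
(Gross–Zagier at every level, Gross–Zagier–Kolyvagin rank theorem, modularity / entire `L`, Milne any-model base change).
Its closer was landed in advance by seat bsd-line-gk2-p3 (`GenusExactDescent.exactDescentAtTwo_ofFourFacts`,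
`Theorems/GenusKolyvaginAtTwoExactDescentAtTwoOfFourFacts.lean`, p588019), whose type is the item's body verbatim; this
file only states the theorem AT THE ROUTE DECL, as the gate requires (`--workitem stmt-BirchSwinnertonDyer-24238`).
Cell `bsd-f1-sign2`, seat `bsd-line-gk2-p4`. Nothing new is proved here; the mathematics (Gross–Zagier V.§2 bookkeeping,
E(K[1])[2] = 0, Milne descent, the twin's analytic rank is exactly `1`) is p3's, conditional on the four named facts that
the item displays as hypotheses. BSD is not proved by any of this.
-/

set_option linter.dupNamespace false -- tree convention: `Summit.BirchSwinnertonDyer.BirchSwinnertonDyer.Theorems` (D-0017)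

namespace Summit.BirchSwinnertonDyer.BirchSwinnertonDyer.Theorems.GenusExactDescent

/-- **Item 24238 `ExactDescentAtTwoOfFourFacts` holds** — by `exactDescentAtTwo_ofFourFacts` (seat gk2-p3, p588019):
granted (Gross–Zagier ∀ N) ∧ GZK ∧ `hasEntireLFunction_rat` ∧ Milne any-model, the quadratic `2`-descent of exactness
`ExactDescentAtTwo` holds. [cite: GrossZagier1986, V.§2] [cite: Milne1972ArithmeticAV, §1 Thm 1] -/
theorem exactDescentAtTwoOfFourFacts_proof :
    Summit.BirchSwinnertonDyer.BirchSwinnertonDyer.Theses.GenusKolyvaginAtTwo.ExactDescentAtTwoOfFourFacts := by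
  unfold Summit.BirchSwinnertonDyer.BirchSwinnertonDyer.Theses.GenusKolyvaginAtTwo.ExactDescentAtTwoOfFourFacts
  exact exactDescentAtTwo_ofFourFacts

end Summit.BirchSwinnertonDyer.BirchSwinnertonDyer.Theorems.GenusExactDescent
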